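import Summits.AtomisticToContinuum.HydrodynamicLimit.Theorems.JParityClosureLocalSecondLawContactPinnedRepresentationMeans
import Summits.AtomisticToContinuum.HydrodynamicLimit.Theorems.JParityClosureLocalSecondLawContactPinnedRepresentationBox
import Summits.AtomisticToContinuum.HydrodynamicLimit.Theorems.JParityClosureLocalSecondLawLedgerHonestB
import Summits.AtomisticToContinuum.HydrodynamicLimit.Theorems.LocalSecondLaw.Negative.Saturation
import Summits.AtomisticToContinuum.HydrodynamicLimit.Theorems.JParityClosureLocalSecondLawRegularRangeTools

/-!
# Pinned cells: the pathwise crux functional is the ensemble functional on the REGULAR range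
(crux `JParityClosure.LocalSecondLaw`, stmt-AtomisticToContinuum-13081, line `contact-asymmetry-information`,
stub Q `stub_pinnedRepresentation` — the conditional theorem)

Stub Q of the line asks that on a pinned cell `S ⊆ Pin σ r τ η′ Φ c` of local-Gibbs mass `≥ δ″` at most half of the
mass has its PATHWISE crux functional `I(z)` more than `η` below the ENSEMBLE functional `𝓘[P_N(·|S)]` (crux integrand
at the mean coarse fields of the conditioned law).  As typed it carries the regular-range-in-measure content of the
crux (cold populated balls, packing beyond the equation-of-state band, and — because the velocity `m/ρ` and the entropy
of hot states are not uniformly continuous in the conserved variables — HOT SPOTS), for which no producer exists past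
the Euler blow-up time.  This file proves the DETERMINISTIC CORE under the honest extra hypothesis that the cell lies
in the regular-plus event (`Regular σ r τ c₀ η₁ Φ z` and `e_r ≤ Ē` on `[0, τ] × 𝕋³`), for ANY finite measure carried
by the good set and ANY cell of positive mass (no measurability of the cell):

`contactQ_pinned_of_regular`: given the band `EosBand η₀ F`, `σ, c₀, η₁ < η₀, Ē, τ`, a smooth test function and
`η > 0`, there is a pinning resolution `η′ > 0` (independent of `r`, `N`, the flow, the law and the cell) such that
for every member `z` of such a cell `|I(z) − 𝓘[condLaw μ S]| ≤ η`.

Proof: means of pinned quantities are pinned (`contactQ_mean_pinned`, layer 1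
`…ContactPinnedRepresentationMeans.lean`), so the conserved fields of `Φₛz` and the mean fields are within `2η′` in
sup-distance on `[0, τ] × 𝕋³`; both lie in the neighbourhood of the regular range where the integrand is `L`-Lipschitz
(`pinQ_uniform_package`, layer 2 `…ContactPinnedRepresentationBox.lean`); all four Bochner integrals are honest — the
pathwise ones by `integrableOn_innerE` of the ledger line, the ensemble ones because the mean fields are continuous in
`x` (dominated convergence, speeds bounded on the cell by the capped energy, which is pinned through `∫ e_r = ke`) and
jointly measurable in `(s, x)` (layer 1) — so `|I(z) − 𝓘| ≤ 2Lη′τ ≤ η`.  (`ke = (N+1)⁻¹·configEnergy` is the tree's `rr_ke_eq`.)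

References: H. Spohn, *Large Scale Dynamics of Interacting Particles* (1991), Part I §3; C. Kipnis, C. Landim,
*Scaling Limits of Interacting Particle Systems* (1999), Ch. 4 (uniform continuity on the regular range as the route
from pinned coarse fields to functionals).
-/

noncomputable section

open scoped BigOperators Topology Classical MeasureTheory ENNReal InnerProductSpace NNReal
open Filter Set MeasureTheory Function
open Literature.MathematicalPhysics.KineticTheory
open Literature.Analysis.FluidPDE
open Summit.AtomisticToContinuum.HydrodynamicLimit.Theorems.LocalSecondLawNegative
open Summit.AtomisticToContinuum.HydrodynamicLimit.Theorems.LocalSecondLawLedger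

namespace Summit.AtomisticToContinuum.HydrodynamicLimit.Theorems.LocalSecondLawContact

variable {N : ℕ}

/-! ## Energy and speeds on the cell -/

/-- A cap on the coarse kinetic energy at time `0` caps the total kinetic energy of a good phase point. -/
theorem pinQ_configEnergy_le {σ r Ē : ℝ} (hr : 0 < r) (hr2 : r < 1 / 2) (Φ : Flow σ N) {z : Phase N}
    (hz : z ∈ Φ.good) (hcap : ∀ x, kinC r (Φ.flow 0 z) x ≤ Ē) : configEnergy z ≤ ((N + 1 : ℕ) : ℝ) * Ē := by
  have hke : ke z ≤ Ē := by
    rw [← integral_kinC_eq_ke hr hr2 z]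
    have h1 : ∫ x, kinC r z x ≤ ∫ _x : T3, Ē :=
      integral_mono (integrable_of_continuous_T3 (continuous_kinC r z)) (integrable_const Ē) fun x => by
        have := hcap x; rwa [Φ.flow_zero z hz] at this
    simpa using h1
  rw [rr_ke_eq] at hke
  have hN : (0 : ℝ) < ((N + 1 : ℕ) : ℝ) := by positivity
  rwa [inv_mul_le_iff₀ hN] at hke

/-- Along a good orbit of capped energy all speeds are bounded by `√(2 (N+1) Ē)`. -/
theorem pinQ_flow_mem_KV {σ Ē : ℝ} (Φ : Flow σ N) {z : Phase N} (hz : z ∈ Φ.good)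
    (hK : configEnergy z ≤ ((N + 1 : ℕ) : ℝ) * Ē) (s : ℝ) :
    Φ.flow s z ∈ L.KV N (Real.sqrt (2 * (((N + 1 : ℕ) : ℝ) * Ē))) := fun i =>
  (L.flow_mem_KV Φ hz s i).trans (Real.sqrt_le_sqrt (by linarith))

/-! ## The conditional theorem -/

/-- **Registered conditional form `contactQ_pinned_of_regular` of stub Q** (`stub_pinnedRepresentation`, line
`contact-asymmetry-information`).  On a pinned cell lying in the REGULAR-PLUS event (good orbit, density floor `c₀`,
packing cap `ρ_rσ³ ≤ η₁` inside the equation-of-state band, temperature floor `c₀`, energy cap `e_r ≤ Ē` on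
`[0, τ] × 𝕋³`) of ANY finite measure carried by the good set, every member has its pathwise crux functional within `η`
of the ensemble functional of the conditioned law, once the pinning resolution `η′` is small — uniformly in `r`, `N`,
the flow, the law, the cell and its centre. -/
theorem contactQ_pinned_of_regular : ∀ {η₀ : ℝ} {F : ℝ → ℝ}, EosBand η₀ F → ∀ (σ c₀ η₁ Ē τ : ℝ), 0 < σ → 0 < c₀ → 0 < η₁ → η₁ < η₀ → 0 < τ → ∀ (φ : ℝ → T3 → ℝ), Literature.Analysis.FunctionSpaces.Torus.IsSmoothSpaceTimeOn Set.univ φ → ∀ (η : ℝ), 0 < η → ∃ η' : ℝ, 0 < η' ∧ ∀ {N : ℕ} (r : ℝ), 0 < r → r < 1 / 2 → ∀ (Φ : Flow σ N) (μ : Measure (Phase N)), IsFiniteMeasure μ → μ Φ.goodᶜ = 0 → ∀ (S : Set (Phase N)), μ S ≠ 0 → ∀ (c : Centre), S ⊆ Pin σ r τ η' Φ c → (∀ z ∈ S, Regular σ r τ c₀ η₁ Φ z ∧ ∀ s ∈ Set.Icc (0 : ℝ) τ, ∀ x : T3, kinC r (Φ.flow s z) x ≤ Ē) → ∀ z ∈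 S, |entropyFunctional σ r τ φ Φ z - ensFunctional σ r τ φ (condLaw μ S) Φ| ≤ η := by
  intro η₀ F hE σ c₀ η₁ Ē τ hσ hc hη hη₁ hτ φ hφ η hηpos
  -- constants: test-function bound, then the uniform continuity package
  obtain ⟨A, Kφ, hAK⟩ := L.testFunction_box hφ τ
  obtain ⟨δ₀, hδ₀, Lc, C, hL0, hP⟩ := pinQ_uniform_package hE hσ hc hη hη₁ Ē (A : ℝ)
  refine ⟨min (δ₀ / 2) (η / (2 * Lc * τ + 1) / 2), by positivity, ?_⟩
  intro N r hr hr2 Φ μ hfin hgood S h0 c hS hReg z hz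
  set η' : ℝ := min (δ₀ / 2) (η / (2 * Lc * τ + 1) / 2) with hη'def
  have hη'pos : 0 < η' := by positivity
  have h2η'δ : 2 * η' ≤ δ₀ := by
    have : η' ≤ δ₀ / 2 := min_le_left _ _
    linarith
  have h2η'η : 2 * Lc * η' * τ ≤ η := by
    have h1 : η' ≤ η / (2 * Lc * τ + 1) / 2 := min_le_right _ _
    have h2 : 2 * Lc * τ * (η / (2 * Lc * τ + 1)) ≤ η := by
      rw [mul_div_assoc']
      rw [div_le_iff₀ (by positivity)]
      nlinarith
    have h3 : 0 ≤ 2 * Lc * τ := by positivity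
    nlinarith
  have htop : μ S ≠ ⊤ := measure_ne_top μ S
  set ν : Measure (Phase N) := condLaw μ S with hνdef
  haveI hνP : IsProbabilityMeasure ν := isProbabilityMeasure_condLaw h0 htop
  have hνgood : ν Φ.goodᶜ = 0 := condLaw_null S hgood
  obtain ⟨hR, hcap⟩ := hReg z hz
  have hzg : z ∈ Φ.good := hR.1
  -- abbreviations
  set a : ℝ → T3 → ℝ := fun s x => deriv (fun s' => φ s' x) s with ha
  set b : ℝ → T3 → Fin 3 → ℝ := fun s x k => pD k (φ s) x with hb
  set pbar : ℝ → T3 → L.CV := fun s x =>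
    (rhoBar r ν Φ s x, WithLp.ofLp (momBar r ν Φ s x), kinBar r ν Φ s x) with hpbar
  set Γ : L.CV → ℝ → (Fin 3 → ℝ) → ℝ := fun p a' b' =>
    L.Hhat σ c₀ η₀ η₁ p * (a' + ∑ k, p.2.1 k / p.1 * b' k) with hΓ
  -- the speed bound on the cell and the measurable superset carrying ν
  set V : ℝ := Real.sqrt (2 * (((N + 1 : ℕ) : ℝ) * Ē)) with hV
  have h0τ : (0 : ℝ) ∈ Set.Icc (0 : ℝ) τ := ⟨le_rfl, hτ.le⟩
  have hKV : ∀ z' ∈ S, ∀ s, Φ.flow s z' ∈ L.KV N V := fun z' hz' s =>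
    pinQ_flow_mem_KV Φ (hReg z' hz').1.1 (pinQ_configEnergy_le hr hr2 Φ (hReg z' hz').1.1 ((hReg z' hz').2 0 h0τ)) s
  have haeKV : ∀ s, ∀ᵐ z' ∂ν, Φ.flow s z' ∈ L.KV N V := by
    intro s
    have hEm : Measurable (configEnergy : Phase N → ℝ) := by
      have h : Continuous (configEnergy : Phase N → ℝ) := by
        unfold configEnergy
        exact continuous_const.mul (continuous_finsetSum _ fun i _ =>
          (continuous_snd.comp (continuous_apply i)).norm.pow 2)
      exact h.measurable
    have hT : MeasurableSet (Φ.good ∩ {z' | configEnergy z' ≤ ((N + 1 : ℕ) : ℝ) * Ē}) :=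
      Φ.measurableSet_good.inter (measurableSet_le hEm measurable_const)
    have hST : S ⊆ Φ.good ∩ {z' | configEnergy z' ≤ ((N + 1 : ℕ) : ℝ) * Ē} := fun z' hz' =>
      ⟨(hReg z' hz').1.1, pinQ_configEnergy_le hr hr2 Φ (hReg z' hz').1.1 ((hReg z' hz').2 0 h0τ)⟩
    filter_upwards [ae_mem_condLaw_of_subset (μ := μ) hT hST] with z' hz'
    exact pinQ_flow_mem_KV Φ hz'.1 hz'.2 s
  -- pointwise facts on [0, τ] × 𝕋³
  have hregU : ∀ s ∈ Set.Icc (0 : ℝ) τ, ∀ x, c₀ ≤ (L.U r (Φ.flow s z) x).1 ∧ (L.U r (Φ.flow s z) x).1 * σ ^ 3 ≤ η₁ ∧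
      c₀ ≤ L.thetaOf (L.U r (Φ.flow s z) x).1 (L.U r (Φ.flow s z) x).2.2 (L.U r (Φ.flow s z) x).2.1 ∧
      0 ≤ (L.U r (Φ.flow s z) x).2.2 ∧ (L.U r (Φ.flow s z) x).2.2 ≤ Ē := by
    intro s hs x
    obtain ⟨g1, g2, g3⟩ := hR.2 s hs x
    refine ⟨g1, g2, ?_, kinC_nonneg hr _ _, hcap s hs x⟩
    show c₀ ≤ L.thetaOf (rhoC r (Φ.flow s z) x) (kinC r (Φ.flow s z) x) (WithLp.ofLp (momC r (Φ.flow s z) x))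
    rw [L.thetaOf_U]; exact g3
  have hdist : ∀ s ∈ Set.Icc (0 : ℝ) τ, ∀ x, dist (L.U r (Φ.flow s z) x) (pbar s x) ≤ δ₀ := fun s hs x =>
    (pinQ_dist_U_le hr h0 htop hS hz hs x).trans h2η'δ
  have hab : ∀ s ∈ Set.Icc (0 : ℝ) τ, ∀ x, |a s x| ≤ A ∧ ∀ k, |b s x k| ≤ A := fun s hs x =>
    ⟨(hAK s hs).2.1 x, fun k => (hAK s hs).2.2.1 k x⟩
  -- (E) the pathwise integrand is Γ of the conserved fields
  have hEeq : ∀ s ∈ Set.Icc (0 : ℝ) τ, ∀ x,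
      Hs σ (rhoC r (Φ.flow s z) x) (thetaC r (Φ.flow s z) x) *
          (deriv (fun s' => φ s' x) s + ∑ k, momC r (Φ.flow s z) x k / rhoC r (Φ.flow s z) x * pD k (φ s) x) =
        Γ (L.U r (Φ.flow s z) x) (a s x) (b s x) := fun s hs x =>
    pinQ_integrand_eq_of_regular hc hη₁ (hR.2 s hs) x _ _
  -- (T+X) the ensemble integrand is Γ of the mean fields
  have hTXeq : ∀ s ∈ Set.Icc (0 : ℝ) τ, ∀ x,
      Hs σ (rhoBar r ν Φ s x) (thetaBar r ν Φ s x) * deriv (fun s' => φ s' x) s = Γ (pbar s x) (a s x) 0 ∧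
      Hs σ (rhoBar r ν Φ s x) (thetaBar r ν Φ s x) * ∑ k, uBar r ν Φ s x k * pD k (φ s) x =
        Γ (pbar s x) 0 (b s x) := by
    intro s hs x
    obtain ⟨⟨hqN, -, -⟩, -, -⟩ := hP _ _ (hregU s hs x).1 (hregU s hs x).2.1 (hregU s hs x).2.2.1
      (hregU s hs x).2.2.2.1 (hregU s hs x).2.2.2.2 (hdist s hs x)
    have hH : Hs σ (rhoBar r ν Φ s x) (thetaBar r ν Φ s x) = L.Hhat σ c₀ η₀ η₁ (pbar s x) := by
      rw [pinQ_thetaBar_eq]; exact pinQ_Hs_eq_Hhat hc hη₁ hqN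
    refine ⟨?_, ?_⟩
    · rw [hH]
      simp only [hΓ, ha, Pi.zero_apply, mul_zero, Finset.sum_const_zero, add_zero]
    · rw [hH]
      simp only [hΓ, hb, hpbar, uBar, zero_add]
  -- pointwise closeness and bounds
  have hclose : ∀ s ∈ Set.Icc (0 : ℝ) τ, ∀ x,
      |Γ (L.U r (Φ.flow s z) x) (a s x) (b s x) - Γ (pbar s x) (a s x) (b s x)| ≤ 2 * Lc * η' ∧
      |Γ (L.U r (Φ.flow s z) x) (a s x) (b s x)| ≤ C ∧ |Γ (pbar s x) (a s x) 0| ≤ C ∧ |Γ (pbar s x) 0 (b s x)| ≤ C := by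
    intro s hs x
    obtain ⟨-, -, hΓ'⟩ := hP _ _ (hregU s hs x).1 (hregU s hs x).2.1 (hregU s hs x).2.2.1
      (hregU s hs x).2.2.2.1 (hregU s hs x).2.2.2.2 (hdist s hs x)
    have hA0 : |(0 : ℝ)| ≤ A := by rw [abs_zero]; exact A.2
    obtain ⟨l1, l2, -⟩ := hΓ' (a s x) (b s x) (hab s hs x).1 (hab s hs x).2
    obtain ⟨-, -, l3⟩ := hΓ' (a s x) 0 (hab s hs x).1 (fun _ => hA0)
    obtain ⟨-, -, l4⟩ := hΓ' 0 (b s x) hA0 (hab s hs x).2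
    refine ⟨l1.trans ?_, l2, l3, l4⟩
    calc Lc * dist (L.U r (Φ.flow s z) x) (pbar s x) ≤ Lc * (2 * η') :=
          mul_le_mul_of_nonneg_left (pinQ_dist_U_le hr h0 htop hS hz hs x) hL0
      _ = 2 * Lc * η' := by ring
  have hsplit : ∀ (p : L.CV) (a' : ℝ) (b' : Fin 3 → ℝ), Γ p a' b' = Γ p a' 0 + Γ p 0 b' := by
    intro p a' b'
    simp only [hΓ, Pi.zero_apply, mul_zero, Finset.sum_const_zero, add_zero, zero_add]
    ring
  -- honesty, pathwise
  have hEin : ∀ s ∈ Set.Icc (0 : ℝ) τ, Integrable (fun x => Γ (L.U r (Φ.flow s z) x) (a s x) (b s x)) := by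
    intro s hs
    refine L.integrable_of_abs_le ?_ (fun x => (hclose s hs x).2.1)
    refine Measurable.aestronglyMeasurable ?_
    have hU : Continuous (L.U r (Φ.flow s z)) := L.continuous_U hr _
    have hHc : Continuous fun x => L.Hhat σ c₀ η₀ η₁ (L.U r (Φ.flow s z) x) :=
      ((L.contDiff_Hhat hE hη hη₁ hσ hc).continuous.comp hU :)
    have hac : Continuous (a s) :=
      ((L.continuous_uncurry_deriv_of_smooth hφ).comp ((continuous_const (y := s)).prodMk continuous_id) :)
    have hφs : Continuous (φ s) :=
      ((L.continuous_uncurry_of_smooth hφ).comp ((continuous_const (y := s)).prodMk continuous_id) :)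
    have hbm : ∀ k, Measurable fun x => b s x k := fun k => L.measurable_pD k hφs
    simp only [hΓ]
    refine hHc.measurable.mul (hac.measurable.add (Finset.measurable_sum _ fun k _ => ?_))
    exact (((continuous_apply k).comp (continuous_fst.comp (continuous_snd.comp hU))).measurable.div
      (continuous_fst.comp hU).measurable).mul (hbm k)
  have hEout : IntegrableOn (fun s => ∫ x, Γ (L.U r (Φ.flow s z) x) (a s x) (b s x)) (Set.Icc 0 τ) := by
    have h := L.integrableOn_innerE hE hη hη₁ hσ hr hc hφ Φ hR
    refine h.congr_fun (fun s hs => integral_congr_ae (Eventually.of_forall fun x => hEeq s hs x)) measurableSet_Icc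
  -- honesty, ensemble: continuity in x and joint measurability of the mean fields
  have hpbar_cont : ∀ s, Continuous (pbar s) := fun s =>
    (continuous_rhoBar hr Φ ν s).prodMk (((PiLp.continuous_ofLp 2 _).comp
      (continuous_momBar hr Φ ν s (haeKV s))).prodMk (continuous_kinBar hr Φ ν s (haeKV s)))
  have hpbar_meas : Measurable fun q : ℝ × T3 => pbar q.1 q.2 :=
    (measurable_rhoBar₂ hr Φ ν hνgood).prodMk (((PiLp.continuous_ofLp 2 _).measurable.comp
      (measurable_momBar₂ hr Φ ν hνgood)).prodMk (measurable_kinBar₂ hr Φ ν hνgood))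
  have hHm : Continuous (L.Hhat σ c₀ η₀ η₁) := (L.contDiff_Hhat hE hη hη₁ hσ hc).continuous
  have ha₂ : Measurable (Function.uncurry a) := (L.continuous_uncurry_deriv_of_smooth hφ).measurable
  have hb₂ : ∀ k, Measurable fun q : ℝ × T3 => b q.1 q.2 k := fun k => (L.continuous_uncurry_pD_phi hφ k).measurable
  have hTm : Measurable fun q : ℝ × T3 => Γ (pbar q.1 q.2) (a q.1 q.2) 0 := by
    simp only [hΓ]
    refine (hHm.measurable.comp hpbar_meas).mul (ha₂.add (Finset.measurable_sum _ fun k _ => ?_))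
    exact (((measurable_pi_apply k).comp (measurable_fst.comp (measurable_snd.comp hpbar_meas))).div
      (measurable_fst.comp hpbar_meas)).mul measurable_const
  have hXm : Measurable fun q : ℝ × T3 => Γ (pbar q.1 q.2) 0 (b q.1 q.2) := by
    simp only [hΓ]
    refine (hHm.measurable.comp hpbar_meas).mul (measurable_const.add (Finset.measurable_sum _ fun k _ => ?_))
    exact (((measurable_pi_apply k).comp (measurable_fst.comp (measurable_snd.comp hpbar_meas))).div
      (measurable_fst.comp hpbar_meas)).mul (hb₂ k)
  have hTin : ∀ s ∈ Set.Icc (0 : ℝ) τ, Integrable (fun x => Γ (pbar s x) (a s x) 0) := fun s hs =>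
    L.integrable_of_abs_le (hTm.comp (measurable_const.prodMk measurable_id)).aestronglyMeasurable
      (fun x => (hclose s hs x).2.2.1)
  have hXin : ∀ s ∈ Set.Icc (0 : ℝ) τ, Integrable (fun x => Γ (pbar s x) 0 (b s x)) := fun s hs =>
    L.integrable_of_abs_le (hXm.comp (measurable_const.prodMk measurable_id)).aestronglyMeasurable
      (fun x => (hclose s hs x).2.2.2)
  have hbound_int : ∀ (G : ℝ → T3 → ℝ) (B : ℝ), (∀ s ∈ Set.Icc (0 : ℝ) τ, ∀ x, |G s x| ≤ B) →
      ∀ s ∈ Set.Icc (0 : ℝ) τ, |∫ x, G s x| ≤ B := by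
    intro G B hG s hs
    have h1 := norm_integral_le_of_norm_le_const (μ := (volume : Measure T3)) (f := fun x => G s x) (C := B)
      (Eventually.of_forall fun x => by rw [Real.norm_eq_abs]; exact hG s hs x)
    simpa [Real.norm_eq_abs] using h1
  have hTout : IntegrableOn (fun s => ∫ x, Γ (pbar s x) (a s x) 0) (Set.Icc 0 τ) :=
    L.integrableOn_Icc_of_bound (hTm.stronglyMeasurable.integral_prod_right' (ν := (volume : Measure T3))).measurable
      (hbound_int _ C fun s hs x => (hclose s hs x).2.2.1)
  have hXout : IntegrableOn (fun s => ∫ x, Γ (pbar s x) 0 (b s x)) (Set.Icc 0 τ) :=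
    L.integrableOn_Icc_of_bound (hXm.stronglyMeasurable.integral_prod_right' (ν := (volume : Measure T3))).measurable
      (hbound_int _ C fun s hs x => (hclose s hs x).2.2.2)
  -- rewrite the three functionals through Γ
  have hI : entropyFunctional σ r τ φ Φ z = ∫ s in Set.Icc 0 τ, ∫ x, Γ (L.U r (Φ.flow s z) x) (a s x) (b s x) := by
    unfold entropyFunctional
    refine setIntegral_congr_fun measurableSet_Icc fun s hs => ?_
    exact integral_congr_ae (Eventually.of_forall fun x => hEeq s hs x)
  have hT : ensT σ r τ φ ν Φ = ∫ s in Set.Icc 0 τ, ∫ x, Γ (pbar s x) (a s x) 0 := by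
    unfold ensT
    refine setIntegral_congr_fun measurableSet_Icc fun s hs => ?_
    exact integral_congr_ae (Eventually.of_forall fun x => (hTXeq s hs x).1)
  have hX : ensX σ r τ φ ν Φ = ∫ s in Set.Icc 0 τ, ∫ x, Γ (pbar s x) 0 (b s x) := by
    unfold ensX
    refine setIntegral_congr_fun measurableSet_Icc fun s hs => ?_
    exact integral_congr_ae (Eventually.of_forall fun x => (hTXeq s hs x).2)
  have hETout : IntegrableOn (fun s => (∫ x, Γ (L.U r (Φ.flow s z) x) (a s x) (b s x)) - ∫ x, Γ (pbar s x) (a s x) 0)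
      (Set.Icc 0 τ) := hEout.sub hTout
  have hdiff : entropyFunctional σ r τ φ Φ z - ensFunctional σ r τ φ ν Φ =
      ∫ s in Set.Icc 0 τ, ∫ x, (Γ (L.U r (Φ.flow s z) x) (a s x) (b s x) - Γ (pbar s x) (a s x) (b s x)) := by
    rw [ensFunctional, hI, hT, hX, ← sub_sub, ← integral_sub hEout hTout, ← integral_sub hETout hXout]
    refine setIntegral_congr_fun measurableSet_Icc fun s hs => ?_
    have hETin : Integrable (fun x => Γ (L.U r (Φ.flow s z) x) (a s x) (b s x) - Γ (pbar s x) (a s x) 0) :=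
      (hEin s hs).sub (hTin s hs)
    show ((∫ x, Γ (L.U r (Φ.flow s z) x) (a s x) (b s x)) - ∫ x, Γ (pbar s x) (a s x) 0) - ∫ x, Γ (pbar s x) 0 (b s x) = _
    rw [← integral_sub (hEin s hs) (hTin s hs), ← integral_sub hETin (hXin s hs)]
    refine integral_congr_ae (Eventually.of_forall fun x => ?_)
    show Γ (L.U r (Φ.flow s z) x) (a s x) (b s x) - Γ (pbar s x) (a s x) 0 - Γ (pbar s x) 0 (b s x) =
      Γ (L.U r (Φ.flow s z) x) (a s x) (b s x) - Γ (pbar s x) (a s x) (b s x)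
    rw [hsplit (pbar s x) (a s x) (b s x)]
    ring
  -- the bound
  rw [hdiff]
  haveI : IsFiniteMeasure ((volume : Measure ℝ).restrict (Set.Icc (0 : ℝ) τ)) :=
    ⟨by rw [Measure.restrict_apply_univ]; exact measure_Icc_lt_top⟩
  have hinner : ∀ s ∈ Set.Icc (0 : ℝ) τ,
      ‖∫ x, (Γ (L.U r (Φ.flow s z) x) (a s x) (b s x) - Γ (pbar s x) (a s x) (b s x))‖ ≤ 2 * Lc * η' := by
    intro s hs
    have h1 := norm_integral_le_of_norm_le_const (μ := (volume : Measure T3))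
      (f := fun x => Γ (L.U r (Φ.flow s z) x) (a s x) (b s x) - Γ (pbar s x) (a s x) (b s x)) (C := 2 * Lc * η')
      (Eventually.of_forall fun x => by rw [Real.norm_eq_abs]; exact (hclose s hs x).1)
    simpa using h1
  have h2 := norm_integral_le_of_norm_le_const (μ := (volume : Measure ℝ).restrict (Set.Icc (0 : ℝ) τ))
    (f := fun s => ∫ x, (Γ (L.U r (Φ.flow s z) x) (a s x) (b s x) - Γ (pbar s x) (a s x) (b s x))) (C := 2 * Lc * η')
    ((ae_restrict_iff' measurableSet_Icc).2 (Eventually.of_forall hinner))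
  rw [Real.norm_eq_abs, Measure.real, Measure.restrict_apply_univ, Real.volume_Icc, sub_zero,
    ENNReal.toReal_ofReal hτ.le] at h2
  exact h2.trans h2η'η

/-- **One-sided form consumed by the composition** (after the reshape of stub Q to a pointwise conclusion): on a pinned
regular-plus cell no member has its pathwise functional more than `η` below the ensemble functional. -/
theorem contactQ_pinned_of_regular_ge : ∀ {η₀ : ℝ} {F : ℝ → ℝ}, EosBand η₀ F → ∀ (σ c₀ η₁ Ē τ : ℝ), 0 < σ → 0 < c₀ → 0 < η₁ → η₁ < η₀ → 0 < τ → ∀ (φ : ℝ → T3 → ℝ), Literature.Analysis.FunctionSpaces.Torus.IsSmoothSpaceTimeOn Set.univ φ → ∀ (η : ℝ), 0 < η → ∃ η' : ℝ, 0 < η' ∧ ∀ {N : ℕ} (r : ℝ), 0 < r → r < 1 / 2 → ∀ (Φ : Flow σ N) (μ : Measure (Phase N)), IsFiniteMeasure μ → μ Φ.goodᶜ = 0 → ∀ (S : Set (Phase N)), μ S ≠ 0 → ∀ (c : Centre), S ⊆ Pin σ r τ η' Φ c → (∀ z ∈ S, Regular σ r τ c₀ η₁ Φ z ∧ ∀ s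 ∈ Set.Icc (0 : ℝ) τ, ∀ x : T3, kinC r (Φ.flow s z) x ≤ Ē) → ∀ z ∈ S, ensFunctional σ r τ φ (condLaw μ S) Φ - η ≤ entropyFunctional σ r τ φ Φ z := by
  intro η₀ F hE σ c₀ η₁ Ē τ hσ hc hη hη₁ hτ φ hφ η hηpos
  obtain ⟨η', hη', H⟩ := contactQ_pinned_of_regular hE σ c₀ η₁ Ē τ hσ hc hη hη₁ hτ φ hφ η hηpos
  refine ⟨η', hη', fun r hr hr2 Φ μ hfin hgood S h0 c hS hReg z hz => ?_⟩
  have := (abs_le.1 (H r hr hr2 Φ μ hfin hgood S h0 c hS hReg z hz)).1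
  linarith

/-- **Where measurability enters the registered shape.**  On a NULL-MEASURABLE pinned regular-plus cell the sub-level
event of the registered text of stub Q carries no mass of the cell at all (so `2·μ|_S(…) ≤ μ S` holds trivially).  For a
non-measurable cell `μ|_S` is the restriction to the measurable hull `toMeasurable μ S`, which the deterministic
estimate on `S` does not control — the reason the pointwise reshape of Q is preferable to the `μ.restrict` text. -/
theorem contactQ_restrict_eq_zero_of_regular : ∀ {η₀ : ℝ} {F : ℝ → ℝ}, EosBand η₀ F → ∀ (σ c₀ η₁ Ē τ : ℝ), 0 < σ → 0 < c₀ → 0 < η₁ → η₁ < η₀ → 0 < τ → ∀ (φ : ℝ → T3 → ℝ), Literature.Analysis.FunctionSpaces.Torus.IsSmoothSpaceTimeOn Set.univ φ → ∀ (η : ℝ), 0 < η → ∃ η' : ℝ, 0 < η' ∧ ∀ {N : ℕ} (r : ℝ), 0 < r → r < 1 / 2 → ∀ (Φ : Flow σ N) (μ : Measure (Phase N)), IsFiniteMeasure μ → μ Φ.goodᶜ = 0 → ∀ (S : Set (Phase N)), μ S ≠ 0 → NullMeasurableSet S μ → ∀ (c : Centre), S ⊆ Pin σ r τ η' Φ c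 → (∀ z ∈ S, Regular σ r τ c₀ η₁ Φ z ∧ ∀ s ∈ Set.Icc (0 : ℝ) τ, ∀ x : T3, kinC r (Φ.flow s z) x ≤ Ē) → μ.restrict S {z | entropyFunctional σ r τ φ Φ z < ensFunctional σ r τ φ (condLaw μ S) Φ - η} = 0 := by
  intro η₀ F hE σ c₀ η₁ Ē τ hσ hc hη hη₁ hτ φ hφ η hηpos
  obtain ⟨η', hη', H⟩ := contactQ_pinned_of_regular hE σ c₀ η₁ Ē τ hσ hc hη hη₁ hτ φ hφ η hηpos
  refine ⟨η', hη', fun r hr hr2 Φ μ hfin hgood S h0 hSm c hS hReg => ?_⟩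
  have hES : {z | entropyFunctional σ r τ φ Φ z < ensFunctional σ r τ φ (condLaw μ S) Φ - η} ∩ S = ∅ := by
    ext z
    simp only [Set.mem_inter_iff, Set.mem_setOf_eq, Set.mem_empty_iff_false, iff_false, not_and]
    intro hlt hz
    have := (abs_le.1 (H r hr hr2 Φ μ hfin hgood S h0 c hS hReg z hz)).1
    linarith
  rw [Measure.restrict_apply₀' hSm, hES, measure_empty]

end Summit.AtomisticToContinuum.HydrodynamicLimit.Theorems.LocalSecondLawContact

end
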